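import Mathlib.FieldTheory.PurelyInseparable.Basic
import Mathlib.FieldTheory.SeparableClosure
import Mathlib.FieldTheory.Finite.Basic
import Literature.NumberTheory.EllipticCurves.FrobeniusEndomorphism
import Literature.NumberTheory.EllipticCurves.FunctionFieldTranslation
import Literature.NumberTheory.EllipticCurves.IsogenyDegreeProofs
import HarnessLib

/-!
# `1 - φ` is separable (Silverman, *AEC*, Cor. III.5.5): discharge of `isSeparable_oneSubFrobeniusIsogeny`

Topic `NumberTheory/EllipticCurves` (trunk T-ELLARITH); the `…Proofs` sibling of
`Literature.NumberTheory.EllipticCurves.FrobeniusEndomorphism` for its named fact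
`WeierstrassCurve.isSeparable_oneSubFrobeniusIsogeny W` (Silverman, *AEC*, 2nd ed., Cor. III.5.5,
last sentence: for an elliptic curve `E` over a finite field `k` with `q` elements and its
`q`-power Frobenius endomorphism `φ`, "the map `1 - φ` is separable", i.e. `K̄(E)` is a separable
extension of `(1 - φ)^* K̄(E)`), which is **proved** here:
`WeierstrassCurve.isSeparable_oneSubFrobeniusIsogeny_holds`. This is one of the printed inputs of
Silverman's proof of Thm. V.1.1 / V.2.3.1 (`#E(𝔽_q) = deg(1 - φ)`) in the decomposition of the
named fact `Literature.AlgebraicGeometry.Motives.isIsogenous_iff_card_point_eq` (`Literature.AlgebraicGeometry.Motives.FaltingsEC`).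

## The proof (differential-free)

Silverman proves III.5.5 with invariant differentials (`(m + nφ)^* ω = m ω`, III.5.2–5.3, and the
criterion II.4.2(c)), which neither Mathlib nor the tree has for function fields of curves. The
proof below only uses the group law and the field theory of Mathlib:

1. (`frobeniusFunctionField`, `frobeniusPoint`) The `q^m`-power map `z ↦ z^{q^m}` of
   `F = K̄(E)` is a ring endomorphism fixing `k = 𝔽_q`, hence a `k`-algebra endomorphism, and so
   acts on `E(F)` — the points of the `k`-curve `E` over the field `F` — as a group homomorphism
   `Frob_{q^m} : (s, t) ↦ (s^{q^m}, t^{q^m})` (Mathlib's `Affine.Point.map`).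
2. (`genericImage_oneSubFrobeniusIsogeny`) **`(1 - φ)(x, y) = (x, y) - (x^q, y^q)` in `E(F)`**,
   where `(x, y)` is the generic point and `((1 - φ)^* x, (1 - φ)^* y) = (1 - φ)(x, y)` is the
   generic value of the isogeny `1 - φ` (`Isogeny.genericImage`, `IsogenyDegree`): the two sides
   have coordinates in `F` with the same values `x(P - σ_q P)`, `y(P - σ_q P)` at all but finitely
   many `P ∈ E(k̄)` (the group law over `F` specialises to the group law over `k̄`:
   `HasValueAt.addX/addY/slope` of `FunctionFieldTranslation`), and an element of `F` is
   determined by its values at infinitely many points (`eq_of_infinite_setOf_hasValueAt`).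
3. (`genericPoint_eq_sum_add_frobeniusPoint`) Applying `Frob_{q^i}` and summing:
   `(x, y) = Σ_{i<m} (u^{q^i}, v^{q^i}) + (x^{q^m}, y^{q^m})` with `(u, v) = (1 - φ)(x, y)`.
4. (`isSeparable_oneSubFrobeniusIsogeny_holds`) Let `L = (1 - φ)^* F = k̄(u, v)` and `S` the
   separable closure of `L` in `F`. As `F / L` is finite (Silverman II.2.4(a), the tree's theorem
   `Isogeny.finiteDimensional_pullbackField_holds`), `F / S` is purely inseparable, so
   `x^{q^m}, y^{q^m} ∈ S` for `m` large (Mathlib `IsPurelyInseparable.pow_mem`). Every summand in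
   3. has coordinates in `S ⊇ L`, and the points with coordinates in `S` form the subgroup
   `E(S) ≤ E(F)`; hence `x, y ∈ S`, and since `F = k̄(x, y)` (`adjoin_X_Y_eq_top`), `S = F`:
   `F / L` is separable (Mathlib `separableClosure.eq_top_iff`).

(The same argument shows that `m + nφ` is separable whenever `m` is invertible in `k`, the full
content of III.5.5; only `1 - φ` is needed and formalised.)

## References

* [SilvermanAEC2009] J. H. Silverman, *The Arithmetic of Elliptic Curves*, 2nd ed., GTM 106,
  Springer 2009: Cor. III.5.5 (PDF p. 76), III.2.3 (group law), proof of Thm. III.6.2(c)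
  (`φ(x₁, y₁) ∈ E₂(K(x₁, y₁))`), Thm. V.1.1 (proof).

## Design

`noncomputable section`, `open scoped Classical`, universe `u`, dot-notation extensions in
`namespace WeierstrassCurve`; built on `FunctionFieldTranslation` (values of rational functions
at points, the generic point) and `IsogenyDegreeProofs` (finiteness, `k̄(E) = k̄(x, y)`). The two
definitions (`frobeniusFunctionField`, `frobeniusPoint`) are real; everything else is proved.
-/

noncomputable section

open scoped Classical

universe u

namespace WeierstrassCurve

open Literature.NumberTheory.EllipticCurves.WeierstrassFunctionField

variable {K : Type u} [Field K]

/-! ## The finite base field: `q = p^n` -/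

section BaseField

variable (K) [Finite K]

/-- For a finite field `k`: `#k = p ^ n` with `p = char k` prime and `n ≥ 1`. [folklore] -/
theorem exists_natCard_eq_ringChar_pow :
    ∃ n : ℕ, (ringChar K).Prime ∧ Nat.card K = ringChar K ^ n ∧ 0 < n := by
  letI := Fintype.ofFinite K
  obtain ⟨n, hp, hn⟩ := FiniteField.card K (ringChar K)
  exact ⟨n, hp, by rw [Nat.card_eq_fintype_card, hn], n.pos⟩

/-- `a ^ q ^ m = a` in a finite field with `q` elements. [folklore] -/
theorem pow_natCard_pow (m : ℕ) (a : K) : a ^ Nat.card K ^ m = a := by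
  letI := Fintype.ofFinite K
  rw [Nat.card_eq_fintype_card, FiniteField.pow_card_pow]

end BaseField

/-! ## The `q^m`-power Frobenius of the function field `K̄(E)` -/

section FunctionFieldFrobenius

variable (W : WeierstrassCurve K)

/-- `K̄(E)` has the characteristic of `k`. [folklore] -/
theorem charP_geomFunctionField : CharP W.geomFunctionField (ringChar K) :=
  (Algebra.charP_iff K W.geomFunctionField (ringChar K)).mp (ringChar.charP K)

variable [Finite K]

/-- In `K̄(E)` (characteristic `p`, `q = p^n`), `z ↦ z ^ q^m` is additive. [folklore] -/
theorem add_pow_natCard_pow (m : ℕ) (a b : W.geomFunctionField) :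
    (a + b) ^ Nat.card K ^ m = a ^ Nat.card K ^ m + b ^ Nat.card K ^ m := by
  obtain ⟨n, hp, hq, -⟩ := exists_natCard_eq_ringChar_pow K
  haveI := charP_geomFunctionField W
  haveI : ExpChar W.geomFunctionField (ringChar K) := ExpChar.prime hp
  rw [hq, ← pow_mul]
  exact add_pow_expChar_pow a b (ringChar K) (n * m)

/-- **The `q^m`-power Frobenius endomorphism of `K̄(E)`**, `z ↦ z ^ q^m`, as a `k`-algebra
endomorphism (it fixes `k = 𝔽_q` pointwise). Silverman, *AEC*, II.2.10–2.11 (the Frobenius and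
`K(C)^q`). [folklore] -/
def frobeniusFunctionField (m : ℕ) : W.geomFunctionField →ₐ[K] W.geomFunctionField where
  toFun z := z ^ Nat.card K ^ m
  map_one' := one_pow _
  map_mul' a b := mul_pow a b _
  map_zero' := zero_pow (pow_ne_zero m (Nat.card_pos (α := K)).ne')
  map_add' := add_pow_natCard_pow W m
  commutes' c := by
    simp only [Algebra.algebraMap_eq_smul_one]
    rw [smul_pow, one_pow, pow_natCard_pow]

/-- `Frob_{q^m} z = z ^ q^m`. [folklore] -/
@[simp]
theorem frobeniusFunctionField_apply (m : ℕ) (z : W.geomFunctionField) :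
    W.frobeniusFunctionField m z = z ^ Nat.card K ^ m :=
  rfl

/-- `Frob_{q^i} ∘ Frob_{q^j} = Frob_{q^(j+i)}`. [folklore] -/
theorem frobeniusFunctionField_comp (i j : ℕ) :
    (W.frobeniusFunctionField i).comp (W.frobeniusFunctionField j) =
      W.frobeniusFunctionField (j + i) := by
  refine AlgHom.ext fun z ↦ ?_
  simp [pow_add, pow_mul]

/-- **The Frobenius on `E(K̄(E))`**: `(s, t) ↦ (s^{q^m}, t^{q^m})`, the map induced on points over
`K̄(E)` by the `k`-algebra endomorphism `Frob_{q^m}` (Mathlib's `Affine.Point.map`; a group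
homomorphism). [folklore] -/
def frobeniusPoint (m : ℕ) :
    (W.baseChange W.geomFunctionField).toAffine.Point →+
      (W.baseChange W.geomFunctionField).toAffine.Point :=
  Affine.Point.map (W' := W) (W.frobeniusFunctionField m)

/-- `Frob_{q^m} (s, t) = (s^{q^m}, t^{q^m})` on affine points. [folklore] -/
theorem frobeniusPoint_some (m : ℕ) {s t : W.geomFunctionField}
    (h : (W.baseChange W.geomFunctionField).toAffine.Nonsingular s t) :
    W.frobeniusPoint m (.some s t h) = .some (s ^ Nat.card K ^ m) (t ^ Nat.card K ^ m)
      ((Affine.baseChange_nonsingular (W := W) (f := W.frobeniusFunctionField m)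
        (W.frobeniusFunctionField m).injective s t).mpr h) :=
  rfl

/-- `Frob_{q^i} (Frob_{q^j} S) = Frob_{q^(j+i)} S` on points. [folklore] -/
theorem frobeniusPoint_frobeniusPoint (i j : ℕ) (S : (W.baseChange W.geomFunctionField).toAffine.Point) :
    W.frobeniusPoint i (W.frobeniusPoint j S) = W.frobeniusPoint (j + i) S := by
  unfold frobeniusPoint
  rw [Affine.Point.map_map, frobeniusFunctionField_comp]

/-- `Frob_{q^0} = id` on points. [folklore] -/
theorem frobeniusPoint_zero (S : (W.baseChange W.geomFunctionField).toAffine.Point) :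
    W.frobeniusPoint 0 S = S := by
  rcases S with _ | ⟨s, t, h⟩
  · rfl
  · rw [frobeniusPoint_some]
    congr 1 <;> simp

end FunctionFieldFrobenius

/-! ## The generic value of `1 - φ`: `(1 - φ)(x, y) = (x, y) - (x^q, y^q)` in `E(K̄(E))` -/

section GenericIdentity

open geomPoints MvPolynomial

variable {W : WeierstrassCurve K} [Finite K]

/-- The elements of `k̄` fixed by `t ↦ t^q` form a finite set (roots of `X^q - X`). [folklore] -/
theorem finite_setOf_pow_natCard_eq :
    {c : AlgebraicClosure K | c ^ Nat.card K = c}.Finite := by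
  have h1 : 1 < Nat.card K := Finite.one_lt_card
  refine ((Polynomial.X ^ Nat.card K - Polynomial.X :
    Polynomial (AlgebraicClosure K)).rootSet_finite (AlgebraicClosure K)).subset fun c hc ↦ ?_
  rw [Polynomial.mem_rootSet']
  refine ⟨?_, ?_⟩
  · rw [Polynomial.map_sub, Polynomial.map_pow, Polynomial.map_X]
    exact FiniteField.X_pow_card_sub_X_ne_zero _ h1
  · simp only [Set.mem_setOf_eq] at hc
    rw [map_sub, map_pow, Polynomial.aeval_X, hc, sub_self]

/-- The geometric points `P` with `x(P)^q = x(P)` (together with `O`) form a finite set. [folklore] -/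
theorem finite_setOf_xy_pow_natCard_eq :
    {P : W.geomPoints | xy P 0 ^ Nat.card K = xy P 0}.Finite := by
  refine ((finite_setOf_pow_natCard_eq (K := K)).biUnion (fun c _ ↦
    geomPoints.finite_setOf_x_eq (W' := W) c) |>.union (Set.finite_singleton 0)).subset ?_
  intro P hP
  simp only [Set.mem_setOf_eq] at hP
  rcases eq_or_ne P 0 with rfl | hP0
  · exact Or.inr rfl
  · obtain ⟨a, b, hab, rfl⟩ := geomPoints.exists_eq_some hP0
    rw [xy_some] at hP
    simp only [Matrix.cons_val_zero] at hP
    exact Or.inl (Set.mem_biUnion hP ⟨b, hab, rfl⟩)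

variable [W.IsElliptic] {σ : Field.absoluteGaloisGroup K}

omit [W.IsElliptic] in
/-- `x^q ≠ x` in `K̄(E)`: `x` is transcendental over `k̄`. [folklore] -/
theorem genX_ne_genX_pow_natCard : W.genX ≠ W.genX ^ Nat.card K := by
  intro h
  apply transcendental_genX W
  refine ⟨Polynomial.X ^ Nat.card K - Polynomial.X,
    FiniteField.X_pow_card_sub_X_ne_zero _ Finite.one_lt_card, ?_⟩
  rw [map_sub, map_pow, Polynomial.aeval_X, ← h, sub_self]

omit [Finite K] [W.IsElliptic] in
/-- The action of `σ_q` on an affine geometric point raises its coordinates to the `q`-th power.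
[folklore] -/
theorem frobenius_smul_some (hσ : ∀ x : AlgebraicClosure K, σ • x = x ^ Nat.card K)
    {a b : AlgebraicClosure K} (hab : (W.baseChange (AlgebraicClosure K)).toAffine.Nonsingular a b)
    (hab' : (W.baseChange (AlgebraicClosure K)).toAffine.Nonsingular (a ^ Nat.card K) (b ^ Nat.card K)) :
    σ • (show W.geomPoints from Affine.Point.some a b hab) = Affine.Point.some _ _ hab' := by
  change Affine.Point.map
      ((show AlgebraicClosure K ≃ₐ[K] AlgebraicClosure K from σ) :
        AlgebraicClosure K →ₐ[K] AlgebraicClosure K) (.some a b hab) = _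
  rw [Affine.Point.map_some]
  congr 1
  · exact hσ a
  · exact hσ b

/-- **Values of `(1 - φ)^* x`, `(1 - φ)^* y` versus the chord through `(x, y)` and `-(x^q, y^q)`.**
At every affine `P = (a, b)` with `a^q ≠ a` where `1 - φ` agrees with its rational representation,
`(1 - φ)^* x` and the `x`-coordinate of `(x, y) - (x^q, y^q) ∈ E(K̄(E))` both have the value
`x((1 - φ) P) = x(P - σ_q P)`, and likewise for `y` (the group law over `K̄(E)` specialises to the
group law over `k̄`, `HasValueAt.addX`/`addY`/`slope`). [folklore] -/
theorem hasValueAt_oneSub_coords (hσ : ∀ x : AlgebraicClosure K, σ • x = x ^ Nat.card K)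
    {P : W.geomPoints}
    (hPB : AgreesWithRationalMapAt W W (W.oneSubFrobeniusIsogeny hσ).rationalRep.P₁
      (W.oneSubFrobeniusIsogeny hσ).rationalRep.Q₁ (W.oneSubFrobeniusIsogeny hσ).rationalRep.P₂
      (W.oneSubFrobeniusIsogeny hσ).rationalRep.Q₂ (W.oneSubFrobeniusIsogeny hσ) P)
    (hPx : xy P 0 ^ Nat.card K ≠ xy P 0) :
    (∃ c, W.HasValueAt (W.oneSubFrobeniusIsogeny hσ).pullbackX P c ∧
      W.HasValueAt ((W.baseChange W.geomFunctionField).toAffine.addX W.genX (W.genX ^ Nat.card K)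
        ((W.baseChange W.geomFunctionField).toAffine.slope W.genX (W.genX ^ Nat.card K) W.genY
          ((W.baseChange W.geomFunctionField).toAffine.negY (W.genX ^ Nat.card K)
            (W.genY ^ Nat.card K)))) P c) ∧
    (∃ d, W.HasValueAt (W.oneSubFrobeniusIsogeny hσ).pullbackY P d ∧
      W.HasValueAt ((W.baseChange W.geomFunctionField).toAffine.addY W.genX (W.genX ^ Nat.card K)
        W.genY
        ((W.baseChange W.geomFunctionField).toAffine.slope W.genX (W.genX ^ Nat.card K) W.genY
          ((W.baseChange W.geomFunctionField).toAffine.negY (W.genX ^ Nat.card K)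
            (W.genY ^ Nat.card K)))) P d) := by
  set ψ := W.oneSubFrobeniusIsogeny hσ with hψ
  set r := ψ.rationalRep with hr
  set q := Nat.card K with hq
  obtain ⟨hP0, hQ₁, hQ₂, h', e⟩ := agreesWithRationalMapAt_iff.mp hPB
  obtain ⟨a, b, hab, hPe⟩ := geomPoints.exists_eq_some hP0
  have hxyP : xy P = ![a, b] := by rw [hPe, xy_some]
  have hPx' : a ≠ a ^ q := by
    intro h
    apply hPx
    rw [hxyP]
    simpa using h.symm
  -- `ψ P = P - σ P`, computed with the chord through `(a, b)` and `-(a^q, b^q)` over `k̄`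
  have habq : (W.baseChange (AlgebraicClosure K)).toAffine.Nonsingular (a ^ q) (b ^ q) := by
    have h1 := (Affine.baseChange_nonsingular (W := W)
      (f := ((show AlgebraicClosure K ≃ₐ[K] AlgebraicClosure K from σ) :
        AlgebraicClosure K →ₐ[K] AlgebraicClosure K))
      ((show AlgebraicClosure K ≃ₐ[K] AlgebraicClosure K from σ) :
        AlgebraicClosure K →ₐ[K] AlgebraicClosure K).injective a b).mpr hab
    have ea : ((show AlgebraicClosure K ≃ₐ[K] AlgebraicClosure K from σ) :
        AlgebraicClosure K →ₐ[K] AlgebraicClosure K) a = a ^ q := hσ a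
    have eb : ((show AlgebraicClosure K ≃ₐ[K] AlgebraicClosure K from σ) :
        AlgebraicClosure K →ₐ[K] AlgebraicClosure K) b = b ^ q := hσ b
    rwa [ea, eb] at h1
  have hσP : σ • P = Affine.Point.some _ _ habq := by
    rw [hPe]
    exact frobenius_smul_some hσ hab habq
  have hψP : ψ P = Affine.Point.some _ _ (Affine.nonsingular_add hab
      ((Affine.nonsingular_neg ..).mpr habq) fun h ↦ hPx' h.1) := by
    rw [oneSubFrobeniusIsogeny_apply, hσP, hPe]
    change Affine.Point.some a b hab + -Affine.Point.some (a ^ q) (b ^ q) habq = _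
    rw [Affine.Point.neg_some]
    exact Affine.Point.add_of_X_ne hPx'
  rw [hψP] at e
  obtain ⟨hxx, hyy⟩ := Affine.Point.some.inj e
  -- values over `K̄(E)`
  have hvx : W.HasValueAt W.genX P a := by simpa [hxyP] using hasValueAt_gen (W := W) P 0
  have hvy : W.HasValueAt W.genY P b := by simpa [hxyP] using hasValueAt_gen (W := W) P 1
  have hvxq : W.HasValueAt (W.genX ^ q) P (a ^ q) := hvx.pow q
  have hvyq : W.HasValueAt (W.genY ^ q) P (b ^ q) := hvy.pow q
  have hvny := hvxq.negY hvyq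
  have hvL := hvx.slope hP0 hvxq hvy hvny hPx'
  have hv1 : W.HasValueAt ψ.pullbackX P (eval (xy P) r.P₁ / eval (xy P) r.Q₁) :=
    hasValueAt_div hP0 hQ₁
  have hv2 : W.HasValueAt ψ.pullbackY P (eval (xy P) r.P₂ / eval (xy P) r.Q₂) :=
    hasValueAt_div hP0 hQ₂
  exact ⟨⟨_, hv1.congr rfl hxx.symm, hvx.addX hvxq hvL⟩, ⟨_, hv2.congr rfl hyy.symm, hvx.addY hvxq hvy hvL⟩⟩

/-- `(x^q, y^q)` is a point of `E(K̄(E))` (the image of the generic point under `Frob_q`).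
[folklore] -/
theorem nonsingular_gen_pow_natCard :
    (W.baseChange W.geomFunctionField).toAffine.Nonsingular (W.genX ^ Nat.card K)
      (W.genY ^ Nat.card K) := by
  have h := (Affine.baseChange_nonsingular (W := W) (f := W.frobeniusFunctionField 1)
    (W.frobeniusFunctionField 1).injective W.genX W.genY).mpr (nonsingular_genX_genY W)
  simpa [pow_one] using h

/-- `Frob_q (x, y) = (x^q, y^q)`. [folklore] -/
theorem frobeniusPoint_one_genericPoint :
    W.frobeniusPoint 1 W.genericPoint =
      Affine.Point.some _ _ (nonsingular_gen_pow_natCard (W := W)) := by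
  rw [genericPoint, frobeniusPoint_some]
  congr 1 <;> simp

/-- **The generic value of `1 - φ`: `(1 - φ)(x, y) = (x, y) - (x^q, y^q)` in `E(K̄(E))`.** The
point `((1 - φ)^* x, (1 - φ)^* y)` (`Isogeny.genericImage`, Silverman's "`φ(x₁, y₁) ∈ E₂(K(x₁, y₁))`",
proof of Thm. III.6.2(c)) of the isogeny `1 - φ` is the difference, in the group `E(K̄(E))`, of the
generic point and its Frobenius twist: both sides have coordinates in `K̄(E)` taking the same
values `x(P - σ_q P)`, `y(P - σ_q P)` at all but finitely many `P ∈ E(k̄)`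
(`hasValueAt_oneSub_coords`), and a rational function is determined by its values at infinitely
many points (`eq_of_infinite_setOf_hasValueAt`). Silverman, *AEC*, III.2.3 (the group law is
given by rational functions with coefficients in `k`) and V.§1 (`1 - φ`). [folklore] -/
theorem genericImage_oneSubFrobeniusIsogeny (hσ : ∀ x : AlgebraicClosure K, σ • x = x ^ Nat.card K) :
    (W.oneSubFrobeniusIsogeny hσ).genericImage =
      W.genericPoint - W.frobeniusPoint 1 W.genericPoint := by
  set ψ := W.oneSubFrobeniusIsogeny hσ with hψ
  set r := ψ.rationalRep with hr
  have hx : W.genX ≠ W.genX ^ Nat.card K := genX_ne_genX_pow_natCard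
  rw [frobeniusPoint_one_genericPoint, genericPoint, sub_eq_add_neg, Affine.Point.neg_some,
    Affine.Point.add_of_X_ne hx]
  -- the set of good points is infinite
  have hinf : {P : W.geomPoints | AgreesWithRationalMapAt W W r.P₁ r.Q₁ r.P₂ r.Q₂ ψ P ∧
      xy P 0 ^ Nat.card K ≠ xy P 0}.Infinite := by
    have hfin := r.finite.union (finite_setOf_xy_pow_natCard_eq (W := W))
    refine hfin.infinite_compl.mono fun P hP ↦ ?_
    simp only [Set.mem_compl_iff, Set.mem_union, Set.mem_setOf_eq, not_or, not_not] at hP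
    exact hP
  change Affine.Point.some ψ.pullbackX ψ.pullbackY ψ.nonsingular_pullback = _
  congr 1
  · apply eq_of_infinite_setOf_hasValueAt
    exact hinf.mono fun P hP ↦
      ⟨(agreesWithRationalMapAt_iff.mp hP.1).1, (hasValueAt_oneSub_coords hσ hP.1 hP.2).1⟩
  · apply eq_of_infinite_setOf_hasValueAt
    exact hinf.mono fun P hP ↦
      ⟨(agreesWithRationalMapAt_iff.mp hP.1).1, (hasValueAt_oneSub_coords hσ hP.1 hP.2).2⟩

/-- **`(x, y) = (1 - φ)(x, y) + (x^q, y^q)`** in `E(K̄(E))`. [folklore] -/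
theorem genericPoint_eq_genericImage_add (hσ : ∀ x : AlgebraicClosure K, σ • x = x ^ Nat.card K) :
    W.genericPoint =
      (W.oneSubFrobeniusIsogeny hσ).genericImage + W.frobeniusPoint 1 W.genericPoint := by
  rw [genericImage_oneSubFrobeniusIsogeny hσ, sub_add_cancel]

end GenericIdentity

/-! ## `K̄(E)` is separable over `(1 - φ)^* K̄(E)` -/

section Separable

variable {W : WeierstrassCurve K} [Finite K] [W.IsElliptic] {σ : Field.absoluteGaloisGroup K}

/-- **Telescoping**: `(x, y) = Σ_{i<m} Frob_{q^i}((1 - φ)(x, y)) + Frob_{q^m}(x, y)` in `E(K̄(E))`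
for every `m` (apply the group homomorphisms `Frob_{q^i}` to `(x, y) = (1 - φ)(x, y) + (x^q, y^q)`
and sum). [folklore] -/
theorem genericPoint_eq_sum_add_frobeniusPoint
    (hσ : ∀ x : AlgebraicClosure K, σ • x = x ^ Nat.card K) (m : ℕ) :
    W.genericPoint =
      (∑ i ∈ Finset.range m, W.frobeniusPoint i (W.oneSubFrobeniusIsogeny hσ).genericImage) +
        W.frobeniusPoint m W.genericPoint := by
  induction m with
  | zero => rw [Finset.sum_range_zero, zero_add, frobeniusPoint_zero]
  | succ m ih =>
    have hstep : W.frobeniusPoint m W.genericPoint =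
        W.frobeniusPoint m (W.oneSubFrobeniusIsogeny hσ).genericImage +
          W.frobeniusPoint (m + 1) W.genericPoint := by
      conv_lhs => rw [genericPoint_eq_genericImage_add hσ]
      rw [map_add, frobeniusPoint_frobeniusPoint, Nat.add_comm]
    rw [Finset.sum_range_succ, add_assoc, ← hstep]
    exact ih

end Separable

section Discharge

variable (W : WeierstrassCurve K)

/-- **Silverman, *AEC*, Cor. III.5.5 (last sentence): `1 - φ` is separable** — discharge of the
named fact `isSeparable_oneSubFrobeniusIsogeny W` of
`Literature.NumberTheory.EllipticCurves.FrobeniusEndomorphism`: for an elliptic curve `E` over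
a finite field `k` with `q` elements and the `q`-power Frobenius `φ`, the function field `K̄(E)`
is a separable extension of `(1 - φ)^* K̄(E)`.

Silverman's proof uses invariant differentials (`(1 - φ)^* ω = ω ≠ 0`, III.5.2–5.3, II.4.2(c)).
The proof given here is differential-free: let `L = (1 - φ)^* K̄(E) = k̄(u, v)` with
`(u, v) = (1 - φ)(x, y) ∈ E(K̄(E))`, and let `S` be the separable closure of `L` in `F = K̄(E)`
(finite over `L`, Silverman II.2.4(a), `Isogeny.finiteDimensional_pullbackField_holds`), so that
`F / S` is purely inseparable and `x^{q^m}, y^{q^m} ∈ S` for `m` large. In the group `E(F)` one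
has `(x, y) = (u, v) + (x^q, y^q)` (`genericPoint_eq_genericImage_add`: the group law commutes
with specialisation), hence, applying the `q^i`-power Frobenius endomorphisms of `F` (which fix
`k = 𝔽_q` and so act on `E(F)` as group homomorphisms) and summing,
`(x, y) = Σ_{i<m} (u^{q^i}, v^{q^i}) + (x^{q^m}, y^{q^m})`. All summands have coordinates in the
field `S ⊇ L ∋ u, v`, and the points with coordinates in `S` form a subgroup (`E(S) ≤ E(F)`), so
`x, y ∈ S`; as `F = k̄(x, y)`, `S = F`, i.e. `F / L` is separable.
[cite: SilvermanAEC2009, Cor. III.5.5] -/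
theorem isSeparable_oneSubFrobeniusIsogeny_holds : W.isSeparable_oneSubFrobeniusIsogeny := by
  intro _ _ σ hσ
  set ψ := W.oneSubFrobeniusIsogeny hσ
  -- `F = K̄(E)` is finite, hence algebraic, over `L = ψ^* K̄(E)`
  haveI : FiniteDimensional ψ.pullbackField W.geomFunctionField :=
    Isogeny.finiteDimensional_pullbackField_holds W W ψ
  haveI : Algebra.IsAlgebraic ψ.pullbackField W.geomFunctionField :=
    Algebra.IsAlgebraic.of_finite _ _
  set S := separableClosure ψ.pullbackField W.geomFunctionField
  rw [← separableClosure.eq_top_iff]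
  -- characteristic `p`, `q = p ^ n`
  obtain ⟨n, hp, hq, hn⟩ := exists_natCard_eq_ringChar_pow K
  haveI := charP_geomFunctionField W
  haveI : CharP S (ringChar K) :=
    RingHom.charP (algebraMap S W.geomFunctionField)
      (FaithfulSMul.algebraMap_injective S W.geomFunctionField) _
  haveI : ExpChar S (ringChar K) := ExpChar.prime hp
  -- `x ^ q ^ m, y ^ q ^ m ∈ S` for `m` large (`F / S` is purely inseparable)
  obtain ⟨a, ha⟩ := IsPurelyInseparable.pow_mem S (ringChar K) W.genX
  obtain ⟨b, hb⟩ := IsPurelyInseparable.pow_mem S (ringChar K) W.genY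
  have hpow_mem : ∀ {z : W.geomFunctionField} {c : ℕ},
      z ^ ringChar K ^ c ∈ (algebraMap S W.geomFunctionField).range → ∀ m, c ≤ m →
        z ^ Nat.card K ^ m ∈ S := by
    rintro z c ⟨w, hw⟩ m hcm
    have hle : c ≤ n * m := le_trans hcm (Nat.le_mul_of_pos_left m hn)
    obtain ⟨e, he⟩ := Nat.exists_eq_add_of_le hle
    have hz : z ^ Nat.card K ^ m = (z ^ ringChar K ^ c) ^ ringChar K ^ e := by
      rw [hq, ← pow_mul, he, pow_add, pow_mul]
    rw [hz, ← hw]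
    exact pow_mem w.2 _
  set m := a + b
  have hxm : W.genX ^ Nat.card K ^ m ∈ S := hpow_mem ha m (Nat.le_add_right a b)
  have hym : W.genY ^ Nat.card K ^ m ∈ S := hpow_mem hb m (Nat.le_add_left b a)
  -- the subgroup `E(S) ≤ E(F)` of points with coordinates in `S`
  set S' : IntermediateField (AlgebraicClosure K) W.geomFunctionField :=
    S.restrictScalars (AlgebraicClosure K)
  have hmemS' : ∀ {z : W.geomFunctionField}, z ∈ S' ↔ z ∈ S := fun {z} ↦
    IntermediateField.mem_restrictScalars (AlgebraicClosure K)
  set ι : S' →ₐ[K] W.geomFunctionField := (S'.val).restrictScalars K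
  have hιinj : Function.Injective ι := (S'.val).injective
  set H : AddSubgroup (W.baseChange W.geomFunctionField).toAffine.Point :=
    (Affine.Point.map (W' := W) ι).range
  have hmem_of : ∀ {u v : W.geomFunctionField}
      (h : (W.baseChange W.geomFunctionField).toAffine.Nonsingular u v),
      u ∈ S' → v ∈ S' → Affine.Point.some u v h ∈ H := by
    intro u v h hu hv
    refine ⟨Affine.Point.some ⟨u, hu⟩ ⟨v, hv⟩
      ((Affine.baseChange_nonsingular (W := W) (f := ι) hιinj ⟨u, hu⟩ ⟨v, hv⟩).mp h), ?_⟩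
    rw [Affine.Point.map_some]
    rfl
  have hcoord_of_mem : ∀ {Q : (W.baseChange W.geomFunctionField).toAffine.Point}, Q ∈ H →
      ∀ {u v : W.geomFunctionField}
        {h : (W.baseChange W.geomFunctionField).toAffine.Nonsingular u v},
        Q = Affine.Point.some u v h → u ∈ S' ∧ v ∈ S' := by
    rintro Q ⟨Q', rfl⟩ u v h hQ
    rcases Q' with _ | ⟨u', v', h'⟩
    · exact (Affine.Point.some_ne_zero h (by rw [← hQ]; rfl)).elim
    · rw [Affine.Point.map_some] at hQ
      obtain ⟨hu, hv⟩ := Affine.Point.some.inj hQ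
      exact ⟨hu ▸ u'.2, hv ▸ v'.2⟩
  -- `u = ψ^* x`, `v = ψ^* y` lie in `L ⊆ S`
  have hL : ∀ {z : W.geomFunctionField}, z ∈ ψ.pullbackField → z ∈ S' := fun {z} hz ↦ by
    rw [hmemS']
    exact IntermediateField.algebraMap_mem S (⟨z, hz⟩ : ψ.pullbackField)
  have hu : ψ.pullbackX ∈ S' :=
    hL (IntermediateField.subset_adjoin _ _ (Set.mem_insert _ _))
  have hv : ψ.pullbackY ∈ S' :=
    hL (IntermediateField.subset_adjoin _ _ (Set.mem_insert_of_mem _ (Set.mem_singleton _)))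
  -- all the summands of the telescoping identity lie in `H`, hence so does `(x, y)`
  have hBi : ∀ i, W.frobeniusPoint i ψ.genericImage ∈ H := fun i ↦ by
    change W.frobeniusPoint i (Affine.Point.some _ _ ψ.nonsingular_pullback) ∈ H
    rw [frobeniusPoint_some]
    exact hmem_of _ (pow_mem hu _) (pow_mem hv _)
  have hAm : W.frobeniusPoint m W.genericPoint ∈ H := by
    rw [genericPoint, frobeniusPoint_some]
    exact hmem_of _ ((hmemS').mpr hxm) ((hmemS').mpr hym)
  have hA0 : W.genericPoint ∈ H := by
    rw [genericPoint_eq_sum_add_frobeniusPoint hσ m]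
    exact H.add_mem (H.sum_mem fun i _ ↦ hBi i) hAm
  obtain ⟨hxS, hyS⟩ := hcoord_of_mem hA0 (rfl : W.genericPoint = Affine.Point.some _ _ _)
  -- `F = k̄(x, y)`, so `S = F`
  have htop : S' = ⊤ := by
    rw [eq_top_iff, ← adjoin_X_Y_eq_top ((W.baseChange (AlgebraicClosure K)).toAffine),
      IntermediateField.adjoin_le_iff]
    rintro z (rfl | rfl)
    · exact hxS
    · exact hyS
  apply IntermediateField.restrictScalars_injective (AlgebraicClosure K)
  rw [IntermediateField.restrictScalars_top]
  exact htop

end Discharge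

end WeierstrassCurve
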